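import Summits.AnomalousDissipation.AnomalousDissipation.Theses.MomentParity
import Literature.Analysis.FluidPDE.NSGalerkinFourier

/-!
# CubicParityLoud — crux-ideate sketch (ideator 2, round 1): first lemmas of three lines

All statements are in Fourier–Galerkin COEFFICIENT coordinates over the tree's
`Torus.convectionCoeff` / `Torus.leraySym` / `Torus.galerkinField` (NSGalerkinFourier) and
`Torus.IsConjSymm` / `Torus.IsTransversal` / `Torus.freqBall` (TorusTrigPoly).
Nothing is proved here; every `def … : Prop` is a first checkable statement of a line.
-/

noncomputable section

namespace Summit.AnomalousDissipation.AnomalousDissipation.Cruxes.CubicParityLoud.Ideate2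

set_option linter.dupNamespace false

open Literature.Analysis.FunctionSpaces Literature.Analysis.FluidPDE
open scoped BigOperators ComplexConjugate InnerProductSpace

/-- Integer frequencies of `T³`. -/
abbrev Z3 : Type := Fin 3 → ℤ
/-- Complex velocity amplitudes. -/
abbrev C3 : Type := EuclideanSpace ℂ (Fin 3)

/-- The level-`N` frequency set of the crux: `0 < |k|² ≤ N²`. -/
def ballSet (N : ℕ) : Finset Z3 := (Torus.freqBall N).erase 0

/-- Admissible coefficient families = Fourier coordinates of the level-`N` Galerkin space `V_N`:
real (conjugate symmetric), solenoidal (transversal) and supported on `ballSet N`. -/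
def IsAdmissible (N : ℕ) (c : Z3 → C3) : Prop :=
  Torus.IsConjSymm c ∧ Torus.IsTransversal (ballSet N) c ∧ ∀ k ∉ ballSet N, c k = 0

/-- The Galerkin–EULER field at level `N` (`ν = 0`, no force): `k ↦ -Π_k 𝓕[(u·∇)u](k)` on the ball,
`0` off it. -/
def eulerField (N : ℕ) (c : Z3 → C3) (k : Z3) : C3 :=
  if k ∈ ballSet N then Literature.Analysis.FluidPDE.Torus.galerkinField 0 (ballSet N) 0 c k else 0

/-- The linearised Galerkin–Euler nonlinearity at `e` in the direction `w`:
coefficients of `P_N[(e·∇)w + (w·∇)e]` (`= B_N(e,w) + B_N(w,e)`), on the ball. -/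
def linConvection (N : ℕ) (e w : Z3 → C3) (k : Z3) : C3 :=
  if k ∈ ballSet N then
    Literature.Analysis.FluidPDE.Torus.leraySym k
      (Literature.Analysis.FluidPDE.Torus.convectionCoeff (ballSet N) e w k +
        Literature.Analysis.FluidPDE.Torus.convectionCoeff (ballSet N) w e k)
  else 0

/-- A quadratic observable on `V_N` in coefficient form, given by a kernel of `3 × 3` complex
matrices: `Q_A(c) = Σ_{k,l ∈ ball} Re ⟪c k, A k l (c l)⟫`. (Every real quadratic form on `V_N` is of
this shape; the kernel is not unique, which is harmless for the statements below.) -/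
def quadForm (N : ℕ) (A : Z3 → Z3 → Matrix (Fin 3) (Fin 3) ℂ) (c : Z3 → C3) : ℝ :=
  ∑ k ∈ ballSet N, ∑ l ∈ ballSet N, RCLike.re (inner ℂ (c k) (Matrix.toEuclideanLin (A k l) (c l)))

/-- The polar (symmetrised) bilinear form of `quadForm N A`. -/
def polarForm (N : ℕ) (A : Z3 → Z3 → Matrix (Fin 3) (Fin 3) ℂ) (x y : Z3 → C3) : ℝ :=
  (∑ k ∈ ballSet N, ∑ l ∈ ballSet N,
      (RCLike.re (inner ℂ (x k) (Matrix.toEuclideanLin (A k l) (y l))) +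
        RCLike.re (inner ℂ (y k) (Matrix.toEuclideanLin (A k l) (x l))))) / 2

/-- `Q_A` is a QUADRATIC CASIMIR of level-`N` Galerkin–Euler: its drift `2·polar(B_N-field(c), c)`
vanishes at every state of `V_N`. -/
def IsEulerInvariant (N : ℕ) (A : Z3 → Z3 → Matrix (Fin 3) (Fin 3) ℂ) : Prop :=
  ∀ c : Z3 → C3, IsAdmissible N c → polarForm N A (eulerField N c) c = 0

/-- Energy `Σ ‖c k‖²` (`= ‖u‖²_{L²}` by Parseval). -/
def energyForm (N : ℕ) (c : Z3 → C3) : ℝ := ∑ k ∈ ballSet N, ‖c k‖ ^ 2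

/-- Complex cross product on `ℂ³` (for `curl` in Fourier variables). -/
def crossC (a b : C3) : C3 :=
  WithLp.toLp 2 fun i : Fin 3 =>
    if i = 0 then a 1 * b 2 - a 2 * b 1 else if i = 1 then a 2 * b 0 - a 0 * b 2 else a 0 * b 1 - a 1 * b 0

/-- Helicity `Σ Re ⟪c k, i k × c k⟫` (`= (2π)⁻¹ ∫ u · curl u`). -/
def helicityForm (N : ℕ) (c : Z3 → C3) : ℝ :=
  ∑ k ∈ ballSet N, RCLike.re (inner ℂ (c k) (Complex.I • crossC (Literature.Analysis.FluidPDE.Torus.freqVec k) (c k)))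

/-- A single real plane wave: amplitude `v` at `k`, `conj v` at `-k`, nothing else. For `v ⊥ k` it is
an admissible state with `B_N(e,e) = 0` (steady Euler flow) — the pivot of line A. -/
def singleMode (k : Z3) (v : C3) : Z3 → C3 :=
  fun l => if l = k then v else if l = -k then EuclideanSpace.conjVec v else 0

/-! ## Line A — plane-wave polarization recursion ⇒ classification of quadratic Casimirs -/

/-- **First lemma of line A (single-mode polarization identity).** Polarising the Casimir identity
at a single plane wave `e` (where `B_N(e,e) = 0`) in an arbitrary direction `w ∈ V_N` gives
`polar_A(B_N(e,w) + B_N(w,e), e) = 0`. With `w` a single mode at frequency `d` this is a constraint on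
the two off-diagonal blocks `A(k+d,k)`, `A(k,k-d)` ONLY, i.e. a first-order recursion along `k + ℤd`. -/
def SingleModePolarization : Prop :=
  ∀ (N : ℕ) (A : Z3 → Z3 → Matrix (Fin 3) (Fin 3) ℂ), IsEulerInvariant N A →
    ∀ k ∈ ballSet N, ∀ v : C3, (∑ j, ((k j : ℤ) : ℂ) * v j = 0) →
      ∀ w : Z3 → C3, IsAdmissible N w →
        polarForm N A (linConvection N (singleMode k v) w) (singleMode k v) = 0

/-- **Target of line A (the route's unprinted lemma L2, all `N`).** Beyond a threshold `N₁` the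
quadratic Casimirs of the ball-truncated Euler system are exactly `span{E, H}`. -/
def QuadraticCasimirClassification : Prop :=
  ∃ N₁ : ℕ, ∀ N : ℕ, N₁ ≤ N → ∀ A : Z3 → Z3 → Matrix (Fin 3) (Fin 3) ℂ, IsEulerInvariant N A →
    ∃ a b : ℝ, ∀ c : Z3 → C3, IsAdmissible N c →
      quadForm N A c = a * energyForm N c + b * helicityForm N c

/-- **Local rank lemma of line A (the engine; exact computation `compute/local_rank.py`).** For
frequencies `k ∦ d` with `|k|² ≠ |d|²`, a block `M : k^⊥ → (k+d)^⊥` annihilated by the single-mode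
identity against the wave at `d` — `(v·d)⟨ω, M v⟩ + (ω·k)⟨v, M v⟩ = 0` for all real `v ⊥ k`,
`ω ⊥ d` — vanishes. (For `|k|² = |d|²` the kernel is 2-dimensional; for `k ∥ d` the identity is void.) -/
def LocalRankLemma : Prop :=
  ∀ (k d : Fin 3 → ℝ) (M : Matrix (Fin 3) (Fin 3) ℝ),
    crossProduct k d ≠ 0 → dotProduct k k ≠ dotProduct d d →
    M.mulVec k = 0 → Matrix.vecMul (k + d) M = 0 →
    (∀ v ω : Fin 3 → ℝ, dotProduct v k = 0 → dotProduct ω d = 0 →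
        dotProduct v d * dotProduct ω (M.mulVec v) + dotProduct ω k * dotProduct v (M.mulVec v) = 0) →
    M = 0

/-! ## Line B — immunity by isotropy: the loud sea is invisible to every Casimir but `E`, `H` -/

/-- **First lemma of line B (shell-trace rigidity of Casimirs).** For every quadratic Casimir the
polarisation-averaged diagonal `Σ_{|k|²=r} tr (Π_k A(k,k) Π_k)` is the SAME multiple `σ` of the shell
multiplicity on every non-empty shell `r ≤ N²` (so a translation-invariant, shell-isotropic sea
`C = Σ_r c_r Π_shell(r)` pairs with `A` only through `σ · energy`): the isotropic part of a Casimir is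
energy. -/
def ShellTraceRigidity : Prop :=
  ∃ N₁ : ℕ, ∀ N : ℕ, N₁ ≤ N → ∀ A : Z3 → Z3 → Matrix (Fin 3) (Fin 3) ℂ, IsEulerInvariant N A →
    ∃ σ : ℝ, ∀ r : ℕ, 1 ≤ r → r ≤ N ^ 2 →
      ∑ k ∈ (ballSet N).filter (fun k => Torus.freqNormSq k = (r : ℝ)),
          RCLike.re (Matrix.trace
            ((Matrix.toEuclideanLin.symm (Literature.Analysis.FluidPDE.Torus.leraySymₗ (d := Fin 3) k)) *
              A k k *
              (Matrix.toEuclideanLin.symm (Literature.Analysis.FluidPDE.Torus.leraySymₗ (d := Fin 3) k)))) =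
        σ * (2 * (((ballSet N).filter (fun k => Torus.freqNormSq k = (r : ℝ))).card : ℝ))

/-- **The finite-dimensional LMI that line B reduces the crux to** (no measures, no third moments):
mean `m`, second moment `M` (a PSD kernel dominating `m ⊗ m`), mean-momentum row with Reynolds
stress, the ENERGY row `ν Σ|k|²tr M(k,k) = Re Σ ⟪f̂ k, m k⟫` and the HELICITY row, bounded energy,
loud. Line B: `QuadraticCasimirClassification ∧ (stress images span) ∧ MomentLMI → CubicParityLoud`
via Fialkow–Nie (`Literature.MeasureTheory.Moments.FialkowNie2010_thm13`). -/
def MomentLMI : Prop :=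
  ∀ f : UnitAddTorus (Fin 3) → EuclideanSpace ℝ (Fin 3), Torus.IsSmooth f → Torus.IsDivFree f →
    Torus.HasZeroMean f → f ≠ 0 →
    ∃ E ε ν₀ : ℝ, 0 < ε ∧ 0 < ν₀ ∧ ∀ ν : ℝ, 0 < ν → ν < ν₀ → ∃ N₀ : ℕ, ∀ N : ℕ, N₀ ≤ N →
      ∃ (m : Z3 → C3) (M : Z3 → Z3 → Matrix (Fin 3) (Fin 3) ℂ),
        IsAdmissible N m ∧
        -- `M` is a real, solenoidal, symmetric kernel on the ball with `M - m ⊗ m̄` positive semidefinite: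
        (∀ x : Z3 → C3, IsAdmissible N x →
            0 ≤ ∑ k ∈ ballSet N, ∑ l ∈ ballSet N,
              (RCLike.re (inner ℂ (x k) (Matrix.toEuclideanLin (M k l) (x l)))
                - RCLike.re (inner ℂ (x k) (m k) * inner ℂ (m l) (x l)))) ∧
        -- mean-momentum row: `P_N f̂(k) - ν 4π²|k|² m k = Π_k Σ_{p+q=k} 𝓕[B](M)(p,q)` for `k` in the ball
        (∀ k ∈ ballSet N,
            UnitAddTorus.mFourierCoeff (EuclideanSpace.complexify ∘ f) k
              - (((ν * (4 * Real.pi ^ 2 * Torus.freqNormSq k) : ℝ) : ℂ)) • m k =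
            Literature.Analysis.FluidPDE.Torus.leraySym k
              (∑ p ∈ ballSet N, ∑ q ∈ ballSet N,
                if p + q = k then
                  WithLp.toLp 2 (fun i : Fin 3 =>
                    2 * Real.pi * Complex.I * ∑ j : Fin 3, (q j : ℂ) * M p q j i)
                else 0)) ∧
        -- energy row and helicity row (the two Casimir budgets), bounded energy, loudness:
        (ν * ∑ k ∈ ballSet N, 4 * Real.pi ^ 2 * Torus.freqNormSq k * RCLike.re (Matrix.trace (M k k)) =
            ∑ k ∈ ballSet N, RCLike.re (inner ℂ (UnitAddTorus.mFourierCoeff (EuclideanSpace.complexify ∘ f) k) (m k))) ∧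
        (ν * ∑ k ∈ ballSet N, 4 * Real.pi ^ 2 * Torus.freqNormSq k *
              RCLike.re (∑ i : Fin 3, inner ℂ (EuclideanSpace.single i (1 : ℂ))
                (Complex.I • crossC (Literature.Analysis.FluidPDE.Torus.freqVec k)
                  (Matrix.toEuclideanLin (M k k) (EuclideanSpace.single i (1 : ℂ))))) =
            ∑ k ∈ ballSet N, RCLike.re (inner ℂ
              (Complex.I • crossC (Literature.Analysis.FluidPDE.Torus.freqVec k)
                (UnitAddTorus.mFourierCoeff (EuclideanSpace.complexify ∘ f) k)) (m k))) ∧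
        (∑ k ∈ ballSet N, RCLike.re (Matrix.trace (M k k)) ≤ E) ∧
        (ε ≤ ν * ∑ k ∈ ballSet N, 4 * Real.pi ^ 2 * Torus.freqNormSq k * RCLike.re (Matrix.trace (M k k)))

/-! ## Line C — weak phase-locking of non-local helical triads (Waleffe's sole-donor pattern) -/

/-- **First lemma of line C (helical sole-donor sign lemma, coefficient form).** On every
non-collinear triad `k + p + q = 0` whose leg `k` is strictly the shortest there is a real solenoidal
triad state in which BOTH longer legs gain energy under Galerkin–Euler at that instant (so `k` is the
sole donor): Waleffe's classes with opposite helicities on `p`, `q`. In 2-D no such state exists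
(Fjørtoft), which is the triad-level form of the parity criterion. -/
def HelicalSoleDonor : Prop :=
  ∀ k p q : Z3, k + p + q = 0 → crossProduct (fun i => (k i : ℚ)) (fun i => (p i : ℚ)) ≠ 0 →
    Torus.freqNormSq k < Torus.freqNormSq p → Torus.freqNormSq k < Torus.freqNormSq q →
    ∃ c : Z3 → C3, Torus.IsConjSymm c ∧ Torus.IsTransversal {k, p, q, -k, -p, -q} c ∧
      (∀ l ∉ ({k, p, q, -k, -p, -q} : Finset Z3), c l = 0) ∧
      0 < -RCLike.re (inner ℂ (c p)
            (Literature.Analysis.FluidPDE.Torus.convectionCoeff {k, p, q, -k, -p, -q} c c p)) ∧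
      0 < -RCLike.re (inner ℂ (c q)
            (Literature.Analysis.FluidPDE.Torus.convectionCoeff {k, p, q, -k, -p, -q} c c q))

end Summit.AnomalousDissipation.AnomalousDissipation.Cruxes.CubicParityLoud.Ideate2
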